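import Summits.HodgeConjecture.HodgeConjecture.Theorems.F0LD2ThetaTensorClasses
import Summits.HodgeConjecture.HodgeConjecture.Theorems.F0LD2CurveHolTestVector
import Summits.HodgeConjecture.HodgeConjecture.Theorems.F0LD2FrameTransportPin
import Literature.NumberTheory.Automorphic.Liu2021.ThetaLiftFromLineFrameArchSingle
import HarnessLib

-- As in the lineage (★ `F0LD1ThetaTransportKit`, ★ `F0LD2ThetaTensorClasses`): statements over the theta-kernel datum
-- elaborate to very large types; elaborate sequentially.
set_option Elab.async false

/-!
# Crux `HLiu418`, line LD2 (organ C₂away `ArchTypeAway₂`) — KERNEL KIT «K_c-INVARIANCE ∕ ONE DEFINITE PLACE»: the rank-2 ∕ cone-model twins of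
# ★ `Liu2021.ThetaLiftFromLineCompactInvariance` §2 and ★ `…FrameArchSingle` §2–§3 for an ABSTRACT transport `ιA` PINNED by the matrix
# formula `↑(ιA k) = g_𝔸⁻¹ · k · g_𝔸` under the curve letters' SCALED frame `formCongr c g (t • H) = diagonal dV`

Cell hodgecm-mathlib (D-0151), FLOOR 0; crux item `HLiu418` = stmt-HodgeConjecture-24832 (route `HCCMUnconditional`); half-A line LD2
(`stub_S1b_facts` = #74 `Rogawski1990.curveThetaHodgeTypeNecessity_hol` of socket 27458 `Cruxes/HLiu418/Lines/F0_AlbCm.lean`), organ C₂away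
`ArchTypeAway₂` of the LD2 skeleton (LD2-plan (g0), ED. 5 :358–:396; payer LA1-p01 (g2)).  THEOREMS ONLY (no `def`, no instance, no
notation, no named fact, no `sorry`); `--supports stmt-HodgeConjecture-24832`.  HC_CM is proved only modulo the 7 printed citations
(2 remaining: hLiu418 = stmt-HodgeConjecture-24832, h413 = stmt-HodgeConjecture-24833) until rung 0 closes; this file discharges nothing
printed — kernel glue over ★ `F0LD1ThetaTransportKit` (LD1-p01 (g0)) and ★ `F0LD2ThetaTensorClasses` (LD2-p02 (g0)).

WHAT ([Liu2021, proof of Prop. 4.13 Case 1, l. 2137–2141]: at a complex place `w₀` off the place of `ι` the form is definite and «`π_{∞,w₀}` is the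
trivial character» — read on the theta lift of the line this is the `U(V_{w₀})`-invariance of the projected theta functional
`Ψ ↦ pr_P [Θ̃_Ψ(f) ∘ ιA]`, the input of the Cc closer ★ `F0P2oCcThetaFunctionalCovariance` at `n = 3`):

* §1 (abstract `ιA`, `N = 2`, cone model at `w₁`) — for a discrete `P` containing the non-zero class of a holomorphic cotangent form
  `fh ∈ holCotForms₂ … 𝔣` (★ `UnitaryCurveForms`, A-p01 (g12)), the projected theta classes are invariant under `ιA(K_c(w₁)) × 1`,
  `K_c(w₁) = (ker archAt w₁).map archToAdelic`: `starProjection_toLp_lineThetaLift_pairRep_of_mem_kerArchAt₂ ∕ _sub_` (★ `CompactInvariance` §2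
  over ★ `F0LD2CurveHolTestVector.rightRegular_starProjection_of_mem_kerArchAt₂` and ★ `F0LD1ThetaTransportKit.rightRegular_toLp_lineThetaLift`);
* §2 (PINNED `ιA`, scaled frame, rank-generic `N` then `N = 2`) — ONE DEFINITE PLACE THROUGH THE PINNED TRANSPORT: `arch_smul_eq`
  (`U(t•H)(L ⊗ ℝ) = U(H)(L ⊗ ℝ)`), `exists_mem_kerArchAt_pin_eq_adelicSingle` (`adelicSingle w₀ u ∈ ιA(K_c(w₁))` for `w₀ ≠ w₁`; ★
  `FrameArchSingle` §1 for the unscaled frame of `t • H` through ★ `F0LD2FrameTransportPin.pin_apply`), and the `U(V_{w₀})`-INVARIANCE OF THE THETA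
  FUNCTIONAL `starProjection_toLp_lineThetaLift_pairRep_adelicSingle₂` (= ★ `FrameArchSingle` §3 at rank 2, cone model).

## References
* [Liu2021] Y. Liu, *Fourier–Jacobi cycles and arithmetic relative trace formula*, Camb. J. Math. 9 (2021) = arXiv:2102.11518: proof of
  Prop. 4.13 Case 1 (l. 2137–2141, p. 48); App. D Lem. D.2 (1) (p. 127, l. 5283).
* [BorelJacquet1979] A. Borel, H. Jacquet, PSPM 33.1 (1979), §4.1 (`G(𝔸) = G_∞ × G(𝔸_f)`, `G_∞ = ∏_{v ∣ ∞} G(F_v)`), §4.6.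
* [PlatonovRapinchuk1994] V. Platonov, A. Rapinchuk, *Algebraic Groups and Number Theory* (1994), §2.3, §5.1.
* [DeitmarEchterhoff2014] A. Deitmar, S. Echterhoff, *Principles of Harmonic Analysis*, 2nd ed. (2014), Thm. 7.3.2.
-/

set_option autoImplicit false
-- the mandated namespace has the single-problem summit's repeated segment (`HodgeConjecture.HodgeConjecture`)
set_option linter.dupNamespace false

noncomputable section

open NumberField NumberField.InfinitePlace NumberField.mixedEmbedding MeasureTheory IsDedekindDomain
open scoped Matrix Kronecker ComplexOrder ENNReal TensorProduct SchwartzMap Classical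
open Literature.NumberTheory.Automorphic Literature.NumberTheory.Automorphic.UnitaryGroup
open Literature.NumberTheory.Automorphic.UnitaryGroup.CotangentForms
open Literature.NumberTheory.Automorphic.UnitaryCurveForms
open Literature.NumberTheory.Automorphic.IdeleClassGroup
open Literature.NumberTheory.Automorphic.Liu2021
open Literature.NumberTheory.Automorphic.Liu2021.Def411WeilCarriers
open Literature.NumberTheory.Automorphic.Liu2021.Def411WeilCarriersDoubling
open Literature.NumberTheory.GelbartRogawski1991 Literature.NumberTheory.GelbartRogawski1991.UnitaryDualPair
open Literature.NumberTheory.Weil1964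
open Literature.RepresentationTheory.Liu2021
open Literature.RepresentationTheory.CompactGroups
open Literature.RepresentationTheory.HeisenbergGroup

namespace Summit.HodgeConjecture.HodgeConjecture.Cruxes.HLiu418.F0LD2ThetaKcInvariance

/-! ## §1 `N = 2`, cone model: the projected theta classes of a holomorphic-cotangent `P` are invariant under `ιA(K_c(w₁)) × 1` -/

section Cone

variable (L : Type) [Field L] [NumberField L] [IsCMField L] (H : Matrix (Fin 2) (Fin 2) L)
  {n' : ℕ} (e₁ : Fin 2 × Fin 1 ≃ Fin n') (dV : Fin 2 → L) (hdV : ∀ i, IsCMField.complexConj L (dV i) = dV i)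
  (hdV0 : ∀ i, dV i ≠ 0)
  (ιA : (adelicGroupData (↥(maximalRealSubfield L)) L (IsCMField.complexConj L) 2 H).Adelic →* ↥(UnitaryGroup.adelic (↥(maximalRealSubfield L)) L (IsCMField.complexConj L) 2 (Matrix.diagonal dV)))
  (hιA : Continuous ιA ∧ ∀ ⦃γ : (adelicGroupData (↥(maximalRealSubfield L)) L (IsCMField.complexConj L) 2 H).Adelic⦄,
    γ ∈ (UnitaryGroup.toAdelic (↥(maximalRealSubfield L)) L (IsCMField.complexConj L) 2 H).range →
      ιA γ ∈ (UnitaryGroup.toAdelic (↥(maximalRealSubfield L)) L (IsCMField.complexConj L) 2 (Matrix.diagonal dV)).range)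
  (μ : Literature.NumberTheory.Automorphic.IdeleClassGroup L →ₜ* Circle) (hμ : IsConjugateSymplectic L μ) (a : (↥(maximalRealSubfield L))ˣ)
  (hρ : HasThetaMajorants fun
      (p : ↥(UnitaryGroup.adelic (↥(maximalRealSubfield L)) L (IsCMField.complexConj L) 2 (Matrix.diagonal dV)) × ↥(UnitaryGroup.adelic (↥(maximalRealSubfield L)) L (IsCMField.complexConj L) 1 (JW (↥(maximalRealSubfield L)) L a))) (Φ : piSchwartzBruhat (↥(maximalRealSubfield L)) (Fin n')) =>
        pairRep (↥(maximalRealSubfield L)) L (IsCMField.complexConj L) 2 1 e₁ (Matrix.diagonal dV) (JW (↥(maximalRealSubfield L)) L a)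
          (chiSplittingLine L e₁ dV hdV hdV0 (toHeckeCharacter L μ) (isUnitary_toHeckeCharacter L μ)
            ((isOscillatorChar_toHeckeCharacter_iff μ).mpr hμ) (TW (↥(maximalRealSubfield L)) a)
            (isUnit_det_TW (↥(maximalRealSubfield L)) a) (JW (↥(maximalRealSubfield L)) L a) (JW_eq (↥(maximalRealSubfield L)) L a))
          p Φ)
  [CompactSpace (↥(UnitaryGroup.adelic (↥(maximalRealSubfield L)) L (IsCMField.complexConj L) 2 (Matrix.diagonal dV)) ⧸ (UnitaryGroup.toAdelic (↥(maximalRealSubfield L)) L (IsCMField.complexConj L) 2 (Matrix.diagonal dV)).range)] [MeasurableSpace (↥(UnitaryGroup.adelic (↥(maximalRealSubfield L)) L (IsCMField.complexConj L) 1 (JW (↥(maximalRealSubfield L)) L a)) ⧸ (UnitaryGroup.toAdelic (↥(maximalRealSubfield L)) L (IsCMField.complexConj L) 1 (JW (↥(maximalRealSubfield L)) L a)).range)] (μW : Measure (↥(UnitaryGroup.adelic (↥(maximalRealSubfield L)) L (IsCMField.complexConj L) 1 (JW (↥(maximalRealSubfield L)) L a)) ⧸ (UnitaryGroup.toAdelic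 (↥(maximalRealSubfield L)) L (IsCMField.complexConj L) 1 (JW (↥(maximalRealSubfield L)) L a)).range))
  (Ψ : piSchwartzBruhat (↥(maximalRealSubfield L)) (Fin n'))
  (f : C((↥(UnitaryGroup.adelic (↥(maximalRealSubfield L)) L (IsCMField.complexConj L) 1 (JW (↥(maximalRealSubfield L)) L a)) ⧸ (UnitaryGroup.toAdelic (↥(maximalRealSubfield L)) L (IsCMField.complexConj L) 1 (JW (↥(maximalRealSubfield L)) L a)).range), ℂ))
  [BorelSpace (↥(UnitaryGroup.adelic (↥(maximalRealSubfield L)) L (IsCMField.complexConj L) 1 (JW (↥(maximalRealSubfield L)) L a)) ⧸ (UnitaryGroup.toAdelic (↥(maximalRealSubfield L)) L (IsCMField.complexConj L) 1 (JW (↥(maximalRealSubfield L)) L a)).range)] [IsFiniteMeasure μW]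
  (w₁ : {w : InfinitePlace L // w.IsComplex}) (𝔣 : ConeFrame L H w₁)
  {μA : Measure (adelicGroupData (↥(maximalRealSubfield L)) L (IsCMField.complexConj L) 2 H).automorphicQuotient}
  [(adelicGroupData (↥(maximalRealSubfield L)) L (IsCMField.complexConj L) 2 H).IsAutomorphicMeasure μA]
  [CompactSpace (adelicGroupData (↥(maximalRealSubfield L)) L (IsCMField.complexConj L) 2 H).automorphicQuotient]
  (P : DiscreteAutomorphicRep (adelicGroupData (↥(maximalRealSubfield L)) L (IsCMField.complexConj L) 2 H) μA)
  {fh : (adelicGroupData (↥(maximalRealSubfield L)) L (IsCMField.complexConj L) 2 H).Adelic → ℂ}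
  (hfh : fh ∈ holCotForms₂ (↥(maximalRealSubfield L)) L (IsCMField.complexConj L) H (IsCMField.complexConj_ne_one L)
    (UnitaryGroup.complexConj_smul_infinitePlace L) w₁ 𝔣)
  (hj : MemLp (toQuotFun (adelicGroupData (↥(maximalRealSubfield L)) L (IsCMField.complexConj L) 2 H) fh) 2 μA)
  (hjmem : hj.toLp _ ∈ P.space.toSubmodule) (hjne : hj.toLp _ ≠ 0)

include hfh hjmem hjne in
/-- **THE PROJECTED THETA CLASSES ARE `ιA(K_c(w₁)) × 1`-INVARIANT** (rank 2, cone model, abstract transport): for a `P` containing the non-zero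
class of a holomorphic cotangent form `fh ∈ holCotForms₂ … 𝔣` at `w₁`, every `k ∈ K_c(w₁) = (ker archAt w₁).map archToAdelic`, every
Schwartz–Bruhat `Ψ` and every weight `f`: `pr_P [Θ̃_{ω(ιA k, 1)Ψ}(f) ∘ ιA] = pr_P [Θ̃_Ψ(f) ∘ ιA]` — the left side is `pr_P (R(k) [Θ̃_Ψ(f) ∘ ιA])`
(★ `F0LD1ThetaTransportKit.rightRegular_toLp_lineThetaLift`), `pr_P` commutes with `R(k)` (★ `starProjection_rightRegular`) and `R(k)` fixes `P`
vector by vector (★ `F0LD2CurveHolTestVector.rightRegular_starProjection_of_mem_kerArchAt₂`); the `n = 2` twin of ★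
`Liu2021.starProjection_toLp_lineThetaLift_pairRep_of_mem_cmCompactFactor`.  At a definite place `w ≠ w₁` (`U(H)(L⁺_w) ≤ K_c(w₁)`) this is
Liu's «`π_{∞,w}` is the trivial character» read on the theta lift. [cite: Liu2021, proof of Prop. 4.13 Case 1 (l. 2137–2141, p. 48); App. D Lem. D.2 (1) (l. 5283)]
[cite: BorelJacquet1979, §4.6] -/
theorem starProjection_toLp_lineThetaLift_pairRep_of_mem_kerArchAt₂
    {k : (adelicGroupData (↥(maximalRealSubfield L)) L (IsCMField.complexConj L) 2 H).Adelic}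
    (hk : k ∈ ((archAt (↥(maximalRealSubfield L)) L (IsCMField.complexConj L) 2 H w₁ (UnitaryGroup.complexConj_smul_infinitePlace L w₁.1)
      (IsCMField.complexConj_ne_one L)).ker).map (archToAdelic (↥(maximalRealSubfield L)) L (IsCMField.complexConj L) 2 H)) :
    P.space.toSubmodule.starProjection
        (MemLp.toLp _ (F0LD1ThetaTransportKit.memLp_toQuotFun_lineThetaLift L 2 H e₁ dV hdV hdV0 ιA hιA μ hμ a hρ μW
          ((pairRep (↥(maximalRealSubfield L)) L (IsCMField.complexConj L) 2 1 e₁ (Matrix.diagonal dV) (JW (↥(maximalRealSubfield L)) L a)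
            (chiSplittingLine L e₁ dV hdV hdV0 (toHeckeCharacter L μ) (isUnitary_toHeckeCharacter L μ)
              ((isOscillatorChar_toHeckeCharacter_iff μ).mpr hμ) (TW (↥(maximalRealSubfield L)) a)
              (isUnit_det_TW (↥(maximalRealSubfield L)) a) (JW (↥(maximalRealSubfield L)) L a) (JW_eq (↥(maximalRealSubfield L)) L a)))
            (ιA k, 1) Ψ) f μA 2)) =
      P.space.toSubmodule.starProjection
        (MemLp.toLp _ (F0LD1ThetaTransportKit.memLp_toQuotFun_lineThetaLift L 2 H e₁ dV hdV hdV0 ιA hιA μ hμ a hρ μW Ψ f μA 2)) := by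
  rw [← F0LD1ThetaTransportKit.rightRegular_toLp_lineThetaLift L 2 H e₁ dV hdV hdV0 ιA hιA μ hμ a hρ μW Ψ f μA k,
    DiscreteAutomorphicRep.starProjection_rightRegular]
  exact F0LD2CurveHolTestVector.rightRegular_starProjection_of_mem_kerArchAt₂ P hfh hj hjmem hjne hk _

include hfh hjmem hjne in
/-- **Coinvariant form**: `pr_P` kills the class of `ω(ιA k, 1)Ψ − Ψ` for `k ∈ K_c(w₁)` — the theta functional `Ψ ↦ pr_P [Θ̃_Ψ(f) ∘ ιA]` factors
through the co-invariants of the Weil representation restricted to `ιA(K_c(w₁)) × 1` (the `n = 2` twin of ★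
`Liu2021.starProjection_toLp_lineThetaLift_pairRep_sub_of_mem_cmCompactFactor`). [cite: Liu2021, App. D Lem. D.2 (1) (l. 5283)] [cite: BorelJacquet1979, §4.6] -/
theorem starProjection_toLp_lineThetaLift_pairRep_sub_of_mem_kerArchAt₂
    {k : (adelicGroupData (↥(maximalRealSubfield L)) L (IsCMField.complexConj L) 2 H).Adelic}
    (hk : k ∈ ((archAt (↥(maximalRealSubfield L)) L (IsCMField.complexConj L) 2 H w₁ (UnitaryGroup.complexConj_smul_infinitePlace L w₁.1)
      (IsCMField.complexConj_ne_one L)).ker).map (archToAdelic (↥(maximalRealSubfield L)) L (IsCMField.complexConj L) 2 H)) :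
    P.space.toSubmodule.starProjection
        (MemLp.toLp _ (F0LD1ThetaTransportKit.memLp_toQuotFun_lineThetaLift L 2 H e₁ dV hdV hdV0 ιA hιA μ hμ a hρ μW
          ((pairRep (↥(maximalRealSubfield L)) L (IsCMField.complexConj L) 2 1 e₁ (Matrix.diagonal dV) (JW (↥(maximalRealSubfield L)) L a)
            (chiSplittingLine L e₁ dV hdV hdV0 (toHeckeCharacter L μ) (isUnitary_toHeckeCharacter L μ)
              ((isOscillatorChar_toHeckeCharacter_iff μ).mpr hμ) (TW (↥(maximalRealSubfield L)) a)
              (isUnit_det_TW (↥(maximalRealSubfield L)) a) (JW (↥(maximalRealSubfield L)) L a) (JW_eq (↥(maximalRealSubfield L)) L a)))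
            (ιA k, 1) Ψ - Ψ) f μA 2)) = 0 := by
  rw [sub_eq_add_neg, F0LD2ThetaTensorClasses.toLp_lineThetaLift_add_left L 2 H e₁ dV hdV hdV0 ιA hιA μ hμ a hρ μW f μA, map_add,
    starProjection_toLp_lineThetaLift_pairRep_of_mem_kerArchAt₂ L H e₁ dV hdV hdV0 ιA hιA μ hμ a hρ μW Ψ f w₁ 𝔣 P hfh hj hjmem hjne hk,
    ← neg_one_smul ℂ Ψ, F0LD2ThetaTensorClasses.toLp_lineThetaLift_smul_left L 2 H e₁ dV hdV hdV0 ιA hιA μ hμ a hρ μW f μA, map_smul, neg_one_smul,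
    add_neg_cancel]

end Cone

/-! ## §2 The PINNED transport under the scaled frame: one definite place through `ιA` -/

section PinFrame

variable (L : Type) [Field L] [NumberField L] [IsCMField L] (N : ℕ) (H : Matrix (Fin N) (Fin N) L) (dV : Fin N → L)
  (t : L) (ht : t ≠ 0) (g : GL (Fin N) L)
  (hg : formCongr ((IsCMField.complexConj L : L ≃ₐ[↥(maximalRealSubfield L)] L) : L →+* L) g (t • H) = Matrix.diagonal dV)
  (ιA : (adelicGroupData (↥(maximalRealSubfield L)) L (IsCMField.complexConj L) N H).Adelic →*
    ↥(UnitaryGroup.adelic (↥(maximalRealSubfield L)) L (IsCMField.complexConj L) N (Matrix.diagonal dV)))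
  (hιA : ∀ k, ((ιA k : ↥(UnitaryGroup.adelic (↥(maximalRealSubfield L)) L (IsCMField.complexConj L) N (Matrix.diagonal dV))) :
      GL (Fin N) (AdeleRing (𝓞 L) L)) =
    (toAdeleGL L g)⁻¹ * adelicVal (↥(maximalRealSubfield L)) L (IsCMField.complexConj L) N H k * toAdeleGL L g)

include ht in
/-- **`U(t • H)(L ⊗ ℝ) = U(H)(L ⊗ ℝ)`** as subgroups of `GL_N(L ⊗_ℚ ℝ)` for `t ≠ 0`: the archimedean form of `t • H` is `(t ⊗ 1) • (H ⊗ 1)` with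
`t ⊗ 1` a unit, and the unitary group of a form only sees its similarity class (★ `unitaryGroupOfForm_smul_of_isUnit`; the archimedean
companion of ★ `adelicUnitaryGroup_smul` ∕ ★ `rational_smul`). [cite: PlatonovRapinchuk1994, §2.3] -/
theorem arch_smul_eq :
    arch (↥(maximalRealSubfield L)) L (IsCMField.complexConj L) N (t • H) = arch (↥(maximalRealSubfield L)) L (IsCMField.complexConj L) N H := by
  show unitaryGroupOfForm _ ((t • H).map (mixedEmbedding L)) = unitaryGroupOfForm _ (H.map (mixedEmbedding L))
  rw [Matrix.map_smul' _ _ _ (map_mul (mixedEmbedding L))]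
  exact unitaryGroupOfForm_smul_of_isUnit _ ((IsUnit.mk0 t ht).map (mixedEmbedding L)) _

include ht hg hιA in
/-- **`adelicSingle w₀ u ∈ ιA(K_c(w₁))` for `w₀ ≠ w₁`** (pinned transport, scaled frame): for complex places `w₀ ≠ w₁` of `L` and
`u ∈ U(σ_{w₀} diag dV)(ℂ)`, the one-place element `((u at w₀, 1 elsewhere), 1_f)` of `U(diag dV)(𝔸_{L⁺})` is `ιA k` for some `k` in the compact
factor `K_c(w₁) = (ker archAt w₁).map archToAdelic` of `U(H)(𝔸_{L⁺})` (the archimedean elements with trivial `w₁`-component): ★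
`Liu2021.exists_arch_cmAdelicFrameTransport_archToAdelic_eq_adelicSingle` for the unscaled frame of `t • H`, read on `U(H)(𝔸) = U(t • H)(𝔸)` through
★ `F0LD2FrameTransportPin.pin_apply` and `arch_smul_eq` (same matrices throughout).  The rank-generic twin of ★
`Liu2021.exists_mem_cmCompactFactor_cmAdelicFrameTransport_eq_adelicSingle`. [cite: BorelJacquet1979, §4.1] [cite: PlatonovRapinchuk1994, §2.3, §5.1] -/
theorem exists_mem_kerArchAt_pin_eq_adelicSingle (w₀ w₁ : {w : InfinitePlace L // w.IsComplex}) (hw : w₀ ≠ w₁)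
    (u : UnitaryGroup.archLocal L N (Matrix.diagonal dV) w₀) :
    ∃ k ∈ ((archAt (↥(maximalRealSubfield L)) L (IsCMField.complexConj L) N H w₁ (UnitaryGroup.complexConj_smul_infinitePlace L w₁.1)
        (IsCMField.complexConj_ne_one L)).ker).map (archToAdelic (↥(maximalRealSubfield L)) L (IsCMField.complexConj L) N H),
      ιA k = UnitaryGroup.adelicSingle (↥(maximalRealSubfield L)) L (IsCMField.complexConj L) N (Matrix.diagonal dV) (IsCMField.complexConj_ne_one L)
        (complexConj_smul_infinitePlace L) w₀ u := by
  obtain ⟨a', ha', hcomp⟩ := exists_arch_cmAdelicFrameTransport_archToAdelic_eq_adelicSingle L (t • H) dV g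
    (F0LD2ArchAdmissibleAssembly.frame_smul_eq L N H dV t g hg) w₀ u
  -- the same matrix, as an archimedean point of `U(H)`
  let a₀ : arch (↥(maximalRealSubfield L)) L (IsCMField.complexConj L) N H := ⟨a'.1, arch_smul_eq L N H t ht ▸ a'.2⟩
  refine ⟨archToAdelic (↥(maximalRealSubfield L)) L (IsCMField.complexConj L) N H a₀, ?_, ?_⟩
  · refine Subgroup.mem_map_of_mem _ (MonoidHom.mem_ker.2 (Subtype.ext ?_))
    have h1 := congrArg (fun x : UnitaryGroup.archLocal L N (t • H) w₁ => (x : GL (Fin N) ℂ)) (hcomp w₁ (Ne.symm hw))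
    simp only [coe_archAt, OneMemClass.coe_one] at h1
    rw [coe_archAt, OneMemClass.coe_one]
    exact h1
  · rw [F0LD2FrameTransportPin.pin_apply L N H dV t ht g hg ιA hιA, ← ha']
    rfl

end PinFrame

section PinTheta

variable (L : Type) [Field L] [NumberField L] [IsCMField L] (H : Matrix (Fin 2) (Fin 2) L)
  {n' : ℕ} (e₁ : Fin 2 × Fin 1 ≃ Fin n') (dV : Fin 2 → L) (hdV : ∀ i, IsCMField.complexConj L (dV i) = dV i)
  (hdV0 : ∀ i, dV i ≠ 0) (t : L) (ht : t ≠ 0) (g : GL (Fin 2) L)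
  (hg : formCongr ((IsCMField.complexConj L : L ≃ₐ[↥(maximalRealSubfield L)] L) : L →+* L) g (t • H) = Matrix.diagonal dV)
  (ιA : (adelicGroupData (↥(maximalRealSubfield L)) L (IsCMField.complexConj L) 2 H).Adelic →* ↥(UnitaryGroup.adelic (↥(maximalRealSubfield L)) L (IsCMField.complexConj L) 2 (Matrix.diagonal dV)))
  (hιA : Continuous ιA ∧ ∀ ⦃γ : (adelicGroupData (↥(maximalRealSubfield L)) L (IsCMField.complexConj L) 2 H).Adelic⦄,
    γ ∈ (UnitaryGroup.toAdelic (↥(maximalRealSubfield L)) L (IsCMField.complexConj L) 2 H).range →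
      ιA γ ∈ (UnitaryGroup.toAdelic (↥(maximalRealSubfield L)) L (IsCMField.complexConj L) 2 (Matrix.diagonal dV)).range)
  (hpin : ∀ k, ((ιA k : ↥(UnitaryGroup.adelic (↥(maximalRealSubfield L)) L (IsCMField.complexConj L) 2 (Matrix.diagonal dV))) :
      GL (Fin 2) (AdeleRing (𝓞 L) L)) =
    (toAdeleGL L g)⁻¹ * adelicVal (↥(maximalRealSubfield L)) L (IsCMField.complexConj L) 2 H k * toAdeleGL L g)
  (μ : Literature.NumberTheory.Automorphic.IdeleClassGroup L →ₜ* Circle) (hμ : IsConjugateSymplectic L μ) (a : (↥(maximalRealSubfield L))ˣ)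
  (hρ : HasThetaMajorants fun
      (p : ↥(UnitaryGroup.adelic (↥(maximalRealSubfield L)) L (IsCMField.complexConj L) 2 (Matrix.diagonal dV)) × ↥(UnitaryGroup.adelic (↥(maximalRealSubfield L)) L (IsCMField.complexConj L) 1 (JW (↥(maximalRealSubfield L)) L a))) (Φ : piSchwartzBruhat (↥(maximalRealSubfield L)) (Fin n')) =>
        pairRep (↥(maximalRealSubfield L)) L (IsCMField.complexConj L) 2 1 e₁ (Matrix.diagonal dV) (JW (↥(maximalRealSubfield L)) L a)
          (chiSplittingLine L e₁ dV hdV hdV0 (toHeckeCharacter L μ) (isUnitary_toHeckeCharacter L μ)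
            ((isOscillatorChar_toHeckeCharacter_iff μ).mpr hμ) (TW (↥(maximalRealSubfield L)) a)
            (isUnit_det_TW (↥(maximalRealSubfield L)) a) (JW (↥(maximalRealSubfield L)) L a) (JW_eq (↥(maximalRealSubfield L)) L a))
          p Φ)
  [CompactSpace (↥(UnitaryGroup.adelic (↥(maximalRealSubfield L)) L (IsCMField.complexConj L) 2 (Matrix.diagonal dV)) ⧸ (UnitaryGroup.toAdelic (↥(maximalRealSubfield L)) L (IsCMField.complexConj L) 2 (Matrix.diagonal dV)).range)] [MeasurableSpace (↥(UnitaryGroup.adelic (↥(maximalRealSubfield L)) L (IsCMField.complexConj L) 1 (JW (↥(maximalRealSubfield L)) L a)) ⧸ (UnitaryGroup.toAdelic (↥(maximalRealSubfield L)) L (IsCMField.complexConj L) 1 (JW (↥(maximalRealSubfield L)) L a)).range)] (μW : Measure (↥(UnitaryGroup.adelic (↥(maximalRealSubfield L)) L (IsCMField.complexConj L) 1 (JW (↥(maximalRealSubfield L)) L a)) ⧸ (UnitaryGroup.toAdelic (↥(maximalRealSubfield L)) L (IsCMField.complexConj L) 1 (JW (↥(maximalRealSubfield L)) L a)).range))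
  (Ψ : piSchwartzBruhat (↥(maximalRealSubfield L)) (Fin n'))
  (f : C((↥(UnitaryGroup.adelic (↥(maximalRealSubfield L)) L (IsCMField.complexConj L) 1 (JW (↥(maximalRealSubfield L)) L a)) ⧸ (UnitaryGroup.toAdelic (↥(maximalRealSubfield L)) L (IsCMField.complexConj L) 1 (JW (↥(maximalRealSubfield L)) L a)).range), ℂ))
  [BorelSpace (↥(UnitaryGroup.adelic (↥(maximalRealSubfield L)) L (IsCMField.complexConj L) 1 (JW (↥(maximalRealSubfield L)) L a)) ⧸ (UnitaryGroup.toAdelic (↥(maximalRealSubfield L)) L (IsCMField.complexConj L) 1 (JW (↥(maximalRealSubfield L)) L a)).range)] [IsFiniteMeasure μW]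
  (w₁ : {w : InfinitePlace L // w.IsComplex}) (𝔣 : ConeFrame L H w₁)
  {μA : Measure (adelicGroupData (↥(maximalRealSubfield L)) L (IsCMField.complexConj L) 2 H).automorphicQuotient}
  [(adelicGroupData (↥(maximalRealSubfield L)) L (IsCMField.complexConj L) 2 H).IsAutomorphicMeasure μA]
  [CompactSpace (adelicGroupData (↥(maximalRealSubfield L)) L (IsCMField.complexConj L) 2 H).automorphicQuotient]
  (P : DiscreteAutomorphicRep (adelicGroupData (↥(maximalRealSubfield L)) L (IsCMField.complexConj L) 2 H) μA)
  {fh : (adelicGroupData (↥(maximalRealSubfield L)) L (IsCMField.complexConj L) 2 H).Adelic → ℂ}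
  (hfh : fh ∈ holCotForms₂ (↥(maximalRealSubfield L)) L (IsCMField.complexConj L) H (IsCMField.complexConj_ne_one L)
    (UnitaryGroup.complexConj_smul_infinitePlace L) w₁ 𝔣)
  (hj : MemLp (toQuotFun (adelicGroupData (↥(maximalRealSubfield L)) L (IsCMField.complexConj L) 2 H) fh) 2 μA)
  (hjmem : hj.toLp _ ∈ P.space.toSubmodule) (hjne : hj.toLp _ ≠ 0)

include ht hg hpin hfh hjmem hjne in
/-- **THE THETA FUNCTIONAL IS `U(V_{w₀})`-INVARIANT at every complex place `w₀ ≠ w₁`** (rank 2, cone model, pinned transport under the scaled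
frame): for a `P` containing the non-zero class of a holomorphic cotangent form at `w₁`, every `u ∈ U(σ_{w₀} diag dV)(ℂ)`, every Schwartz–Bruhat `Ψ`
and every weight `f`: `pr_P [Θ̃_{ω((adelicSingle w₀ u), 1)Ψ}(f) ∘ ιA] = pr_P [Θ̃_Ψ(f) ∘ ιA]` (§1 at the element of `K_c(w₁)` of
`exists_mem_kerArchAt_pin_eq_adelicSingle`; the class is read for ANY transport witness `hιA`, e.g. ★ `F0LD2FrameTransportPin.continuous_of_pin ∕
mem_range_toAdelic_of_pin` of the pin `hpin`) — the `n = 2` twin of ★ `Liu2021.starProjection_toLp_lineThetaLift_pairRep_adelicSingle`: Liu's «`π_{∞,w₀}` is the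
trivial character» read on the theta lift. [cite: Liu2021, proof of Prop. 4.13 Case 1 (l. 2137–2141, p. 48); App. D Lem. D.2 (1) (l. 5283)]
[cite: BorelJacquet1979, §4.6] -/
theorem starProjection_toLp_lineThetaLift_pairRep_adelicSingle₂ (w₀ : {w : InfinitePlace L // w.IsComplex}) (hw₀ : w₀ ≠ w₁)
    (u : UnitaryGroup.archLocal L 2 (Matrix.diagonal dV) w₀) :
    P.space.toSubmodule.starProjection
        (MemLp.toLp _ (F0LD1ThetaTransportKit.memLp_toQuotFun_lineThetaLift L 2 H e₁ dV hdV hdV0 ιA hιA μ hμ a hρ μW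
          ((pairRep (↥(maximalRealSubfield L)) L (IsCMField.complexConj L) 2 1 e₁ (Matrix.diagonal dV) (JW (↥(maximalRealSubfield L)) L a)
            (chiSplittingLine L e₁ dV hdV hdV0 (toHeckeCharacter L μ) (isUnitary_toHeckeCharacter L μ)
              ((isOscillatorChar_toHeckeCharacter_iff μ).mpr hμ) (TW (↥(maximalRealSubfield L)) a)
              (isUnit_det_TW (↥(maximalRealSubfield L)) a) (JW (↥(maximalRealSubfield L)) L a) (JW_eq (↥(maximalRealSubfield L)) L a)))
            (UnitaryGroup.adelicSingle (↥(maximalRealSubfield L)) L (IsCMField.complexConj L) 2 (Matrix.diagonal dV) (IsCMField.complexConj_ne_one L)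
              (complexConj_smul_infinitePlace L) w₀ u, 1) Ψ) f μA 2)) =
      P.space.toSubmodule.starProjection
        (MemLp.toLp _ (F0LD1ThetaTransportKit.memLp_toQuotFun_lineThetaLift L 2 H e₁ dV hdV hdV0 ιA hιA μ hμ a hρ μW Ψ f μA 2)) := by
  obtain ⟨k, hk, hke⟩ := exists_mem_kerArchAt_pin_eq_adelicSingle L 2 H dV t ht g hg ιA hpin w₀ w₁ hw₀ u
  rw [← hke]
  exact starProjection_toLp_lineThetaLift_pairRep_of_mem_kerArchAt₂ L H e₁ dV hdV hdV0 ιA hιA μ hμ a hρ μW Ψ f w₁ 𝔣 P hfh hj hjmem hjne hk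

end PinTheta

end Summit.HodgeConjecture.HodgeConjecture.Cruxes.HLiu418.F0LD2ThetaKcInvariance

end
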